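import Summits.AtomisticToContinuum.FouriersLaw.Theorems.OddSectorIrreversibilityResponseDensityEnergyCutoff
import Summits.AtomisticToContinuum.FouriersLaw.Theorems.OddSectorIrreversibilityResponseDensityMomentumFlip

/-!
# The interpolation functional `Ψ_R(s) = ∫ π χ_R · P_{t-s}(G∘Θ)∘Θ · P_s F dx`: differentiability

Helper file for item stmt-AtomisticToContinuum-9144 (`ResponseDensity`, route
`OddSectorIrreversibility`, sub-problem `FouriersLaw` of `AtomisticToContinuum`), part of the
detailed-balance (hDUAL) line. Both baths at `T > 0`, `π = e^{-H/T}`, `Θ(q,p) = (q,-p)`,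
`F, G ∈ C_c^∞`, `u_s = P_s F`, `w_r = P_r(G∘Θ)`, `χ_R = χ(H/R)`:

* `pinnedChain_hasDerivAt_dualityFunctional` — for `0 < s < t` and `R > 0`,
  `d/ds Ψ_R(s) = ∫ π χ_R (-(P_{t-s} L(G∘Θ))(Θx) u_s(x) + w_{t-s}(Θx) P_s(LF)(x)) dx` (Dynkin
  derivatives of the forecasts, differentiation under the integral sign over the compact support of
  `χ_R`).

No definitions.
-/

noncomputable section

open MeasureTheory ProbabilityTheory Filter Topology Set Function Metric
open scoped NNReal ENNReal ContDiff

namespace Summit.AtomisticToContinuum.FouriersLaw.Theorems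

open Literature.MathematicalPhysics.KineticTheory.HeatConduction
open Literature.Probability.Process Literature.MathematicalPhysics.KineticTheory OscillatorChain

variable {N : ℕ}

section Duality

variable {ω₂ lam β γ : ℝ} (hω : 0 < ω₂) (hl : 0 ≤ lam) (hβ : 0 ≤ β) (hγ : 0 < γ) (hN : 0 < N)
  {T : ℝ} (hT : 0 < T) {F G : PhaseSpace N → ℝ} (hF : ContDiff ℝ ∞ F) (hFc : HasCompactSupport F)
  (hG : ContDiff ℝ ∞ G) (hGc : HasCompactSupport G)
include hω hl hβ hγ hN hT hF hFc hG hGc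

/-- **The derivative of the interpolation functional.** For `0 < s < t` and `R > 0`, with
`u_r = P_r F`, `w_r = P_r(G∘Θ)`, `Ψ_R(s) = ∫ π χ_R w_{t-s}(Θx) u_s(x) dx`:
`Ψ_R'(s) = ∫ π χ_R (-(P_{t-s} L(G∘Θ))(Θx) u_s(x) + w_{t-s}(Θx) P_s(LF)(x)) dx`. -/
theorem pinnedChain_hasDerivAt_dualityFunctional {t : ℝ} {R : ℝ} (hR : 0 < R) {s : ℝ} (hs : 0 < s) (hst : s < t) :
    HasDerivAt (fun r : ℝ => ∫ x, (pinnedChain ω₂ lam β γ).gibbsDensity N T x *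
        smoothCutoff ((pinnedChain ω₂ lam β γ).hamiltonian N x / R) *
        ((∫ y, G (y.1, -y.2) ∂((pinnedChain ω₂ lam β γ).transitionKernel N T T (t - r).toNNReal (x.1, -x.2))) *
          ∫ y, F y ∂((pinnedChain ω₂ lam β γ).transitionKernel N T T r.toNNReal x)))
      (∫ x, (pinnedChain ω₂ lam β γ).gibbsDensity N T x *
        smoothCutoff ((pinnedChain ω₂ lam β γ).hamiltonian N x / R) *
        (-(∫ y, (pinnedChain ω₂ lam β γ).generator N T T (fun z => G (z.1, -z.2)) y
              ∂((pinnedChain ω₂ lam β γ).transitionKernel N T T (t - s).toNNReal (x.1, -x.2))) *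
            (∫ y, F y ∂((pinnedChain ω₂ lam β γ).transitionKernel N T T s.toNNReal x)) +
          (∫ y, G (y.1, -y.2) ∂((pinnedChain ω₂ lam β γ).transitionKernel N T T (t - s).toNNReal (x.1, -x.2))) *
            ∫ y, (pinnedChain ω₂ lam β γ).generator N T T F y
              ∂((pinnedChain ω₂ lam β γ).transitionKernel N T T s.toNNReal x))) s := by
  have hF2 : ContDiff ℝ 2 F := hF.of_le (by norm_cast)
  have hGt : ContDiff ℝ ∞ fun z : PhaseSpace N => G (z.1, -z.2) := contDiff_comp_momentumFlip hG
  have hGtc : HasCompactSupport fun z : PhaseSpace N => G (z.1, -z.2) := hasCompactSupport_comp_momentumFlip hGc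
  have hGt2 : ContDiff ℝ 2 fun z : PhaseSpace N => G (z.1, -z.2) := hGt.of_le (by norm_cast)
  obtain ⟨CF, hCF⟩ : ∃ C, ∀ y, ‖F y‖ ≤ C := hF.continuous.bounded_above_of_compact_support hFc
  obtain ⟨CG, hCG⟩ : ∃ C, ∀ y : PhaseSpace N, ‖G (y.1, -y.2)‖ ≤ C := hGt.continuous.bounded_above_of_compact_support hGtc
  have hLFc : Continuous ((pinnedChain ω₂ lam β γ).generator N T T F) :=
    (pinnedChain ω₂ lam β γ).continuous_generator (pinnedChain_contDiff_U ω₂ lam β γ)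
      (pinnedChain_contDiff_V ω₂ lam β γ) N T T hF2
  have hLGc : Continuous ((pinnedChain ω₂ lam β γ).generator N T T fun z => G (z.1, -z.2)) :=
    (pinnedChain ω₂ lam β γ).continuous_generator (pinnedChain_contDiff_U ω₂ lam β γ)
      (pinnedChain_contDiff_V ω₂ lam β γ) N T T hGt2
  obtain ⟨CLF, hCLF⟩ := (pinnedChain ω₂ lam β γ).exists_bound_generator (pinnedChain_contDiff_U ω₂ lam β γ)
    (pinnedChain_contDiff_V ω₂ lam β γ) N T T hF2 hFc
  obtain ⟨CLG, hCLG⟩ := (pinnedChain ω₂ lam β γ).exists_bound_generator (pinnedChain_contDiff_U ω₂ lam β γ)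
    (pinnedChain_contDiff_V ω₂ lam β γ) N T T hGt2 hGtc
  -- names
  obtain ⟨u, hu⟩ : ∃ u : ℝ → PhaseSpace N → ℝ, u = fun r z =>
      ∫ y, F y ∂((pinnedChain ω₂ lam β γ).transitionKernel N T T r.toNNReal z) := ⟨_, rfl⟩
  obtain ⟨gF, hgF⟩ : ∃ g : ℝ → PhaseSpace N → ℝ, g = fun r z => ∫ y, (pinnedChain ω₂ lam β γ).generator N T T F y
      ∂((pinnedChain ω₂ lam β γ).transitionKernel N T T r.toNNReal z) := ⟨_, rfl⟩
  obtain ⟨w, hw⟩ : ∃ w : ℝ → PhaseSpace N → ℝ, w = fun r z =>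
      ∫ y, G (y.1, -y.2) ∂((pinnedChain ω₂ lam β γ).transitionKernel N T T r.toNNReal z) := ⟨_, rfl⟩
  obtain ⟨gG, hgG⟩ : ∃ g : ℝ → PhaseSpace N → ℝ, g = fun r z =>
      ∫ y, (pinnedChain ω₂ lam β γ).generator N T T (fun z => G (z.1, -z.2)) y
        ∂((pinnedChain ω₂ lam β γ).transitionKernel N T T r.toNNReal z) := ⟨_, rfl⟩
  set π := (pinnedChain ω₂ lam β γ).gibbsDensity N T with hπ
  set χ : PhaseSpace N → ℝ := fun x => smoothCutoff ((pinnedChain ω₂ lam β γ).hamiltonian N x / R) with hχ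
  have hux : ∀ r z, u r z = ∫ y, F y ∂((pinnedChain ω₂ lam β γ).transitionKernel N T T r.toNNReal z) :=
    fun r z => by rw [hu]
  have hwx : ∀ r z, w r z = ∫ y, G (y.1, -y.2) ∂((pinnedChain ω₂ lam β γ).transitionKernel N T T r.toNNReal z) :=
    fun r z => by rw [hw]
  have hgFx : ∀ r z, gF r z = ∫ y, (pinnedChain ω₂ lam β γ).generator N T T F y
      ∂((pinnedChain ω₂ lam β γ).transitionKernel N T T r.toNNReal z) := fun r z => by rw [hgF]
  have hgGx : ∀ r z, gG r z = ∫ y, (pinnedChain ω₂ lam β γ).generator N T T (fun z => G (z.1, -z.2)) y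
      ∂((pinnedChain ω₂ lam β γ).transitionKernel N T T r.toNNReal z) := fun r z => by rw [hgG]
  have hgoal : HasDerivAt (fun r : ℝ => ∫ x, π x * χ x * (w (t - r) (x.1, -x.2) * u r x))
      (∫ x, π x * χ x * (-(gG (t - s) (x.1, -x.2)) * u s x + w (t - s) (x.1, -x.2) * gF s x)) s := by
    -- continuity and bounds of the four forecasts
    have huc : ∀ r, Continuous (u r) := fun r => by
      rw [hu]; exact pinnedChain_continuous_integral_transitionKernel hω hl hβ hγ.le N T T _ hF.continuous hCF
    have hwc : ∀ r, Continuous (w r) := fun r => by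
      rw [hw]; exact pinnedChain_continuous_integral_transitionKernel hω hl hβ hγ.le N T T _ hGt.continuous hCG
    have hgFc : ∀ r, Continuous (gF r) := fun r => by
      rw [hgF]; exact pinnedChain_continuous_integral_transitionKernel hω hl hβ hγ.le N T T _ hLFc hCLF
    have hgGc : ∀ r, Continuous (gG r) := fun r => by
      rw [hgG]; exact pinnedChain_continuous_integral_transitionKernel hω hl hβ hγ.le N T T _ hLGc hCLG
    have hub : ∀ r z, ‖u r z‖ ≤ CF := fun r z => by
      rw [hux, Real.norm_eq_abs]
      exact pinnedChain_abs_forecast_le hω hl hβ hγ.le N T T (fun y => by rw [← Real.norm_eq_abs]; exact hCF y) _ z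
    have hwb : ∀ r z, ‖w r z‖ ≤ CG := fun r z => by
      rw [hwx, Real.norm_eq_abs]
      exact pinnedChain_abs_forecast_le hω hl hβ hγ.le N T T (fun y => by rw [← Real.norm_eq_abs]; exact hCG y) _ z
    have hgFb : ∀ r z, ‖gF r z‖ ≤ CLF := fun r z => by
      haveI := pinnedChain_isMarkovKernel_transitionKernel hω hl hβ hγ.le N T T r.toNNReal
      rw [hgFx]
      calc _ ≤ ∫ y, ‖(pinnedChain ω₂ lam β γ).generator N T T F y‖ ∂((pinnedChain ω₂ lam β γ).transitionKernel N T T r.toNNReal z) :=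
            norm_integral_le_integral_norm _
        _ ≤ ∫ y, CLF ∂((pinnedChain ω₂ lam β γ).transitionKernel N T T r.toNNReal z) :=
            integral_mono_of_nonneg (Eventually.of_forall fun _ => norm_nonneg _) (integrable_const _)
              (Eventually.of_forall fun y => hCLF y)
        _ = CLF := by simp
    have hgGb : ∀ r z, ‖gG r z‖ ≤ CLG := fun r z => by
      haveI := pinnedChain_isMarkovKernel_transitionKernel hω hl hβ hγ.le N T T r.toNNReal
      rw [hgGx]
      calc _ ≤ ∫ y, ‖(pinnedChain ω₂ lam β γ).generator N T T (fun z => G (z.1, -z.2)) y‖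
            ∂((pinnedChain ω₂ lam β γ).transitionKernel N T T r.toNNReal z) := norm_integral_le_integral_norm _
        _ ≤ ∫ y, CLG ∂((pinnedChain ω₂ lam β γ).transitionKernel N T T r.toNNReal z) :=
            integral_mono_of_nonneg (Eventually.of_forall fun _ => norm_nonneg _) (integrable_const _)
              (Eventually.of_forall fun y => hCLG y)
        _ = CLG := by simp
    have hCF0 : 0 ≤ CF := (norm_nonneg _).trans (hCF 0)
    have hCG0 : 0 ≤ CG := (norm_nonneg _).trans (hCG 0)
    have hCLF0 : 0 ≤ CLF := (norm_nonneg _).trans (hCLF 0)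
    have hCLG0 : 0 ≤ CLG := (norm_nonneg _).trans (hCLG 0)
    have hπc : Continuous π := by
      rw [hπ]; exact Real.continuous_exp.comp (((pinnedChain_contDiff_hamiltonian ω₂ lam β γ N (n := 0)).continuous).neg.div_const T)
    have hχc : Continuous χ := (pinnedChain_contDiff_cutoff N γ R (ω₂ := ω₂) (lam := lam) (β := β)).continuous
    have hχs : HasCompactSupport χ := pinnedChain_hasCompactSupport_cutoff hω hl hβ N γ hR
    have hflip : Continuous fun x : PhaseSpace N => ((x.1, -x.2) : PhaseSpace N) := continuous_fst.prodMk continuous_snd.neg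
    -- the dominated-derivative lemma
    set ε := min s (t - s) / 2 with hε
    have hε0 : 0 < ε := by rw [hε]; exact half_pos (lt_min hs (by linarith))
    have hball : ∀ r ∈ ball s ε, 0 < r ∧ r < t := by
      intro r hr
      rw [mem_ball, Real.dist_eq] at hr
      have h1 := abs_lt.1 hr
      have hε1 : ε ≤ s / 2 := by rw [hε]; exact div_le_div_of_nonneg_right (min_le_left _ _) zero_le_two
      have hε2 : ε ≤ (t - s) / 2 := by rw [hε]; exact div_le_div_of_nonneg_right (min_le_right _ _) zero_le_two
      constructor <;> linarith
    have hmeas : ∀ r : ℝ, AEStronglyMeasurable (fun x => π x * χ x * (w (t - r) (x.1, -x.2) * u r x)) volume :=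
      fun r => ((hπc.mul hχc).mul (((hwc (t - r)).comp hflip).mul (huc r))).aestronglyMeasurable
    have hmeas' : AEStronglyMeasurable (fun x => π x * χ x *
        (-(gG (t - s) (x.1, -x.2)) * u s x + w (t - s) (x.1, -x.2) * gF s x)) volume :=
      ((hπc.mul hχc).mul ((((hgGc (t - s)).comp hflip).neg.mul (huc s)).add
        (((hwc (t - s)).comp hflip).mul (hgFc s)))).aestronglyMeasurable
    have hint : Integrable (fun x => π x * χ x * (w (t - s) (x.1, -x.2) * u s x)) :=
      ((hπc.mul hχc).mul (((hwc (t - s)).comp hflip).mul (huc s))).integrable_of_hasCompactSupport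
        (hχs.mul_left.mul_right)
    have hbound : ∀ᵐ x ∂(volume : Measure (PhaseSpace N)), ∀ r ∈ ball s ε,
        ‖π x * χ x * (-(gG (t - r) (x.1, -x.2)) * u r x + w (t - r) (x.1, -x.2) * gF r x)‖ ≤
          |π x * χ x| * (CLG * CF + CG * CLF) := by
      refine Eventually.of_forall fun x r _ => ?_
      rw [norm_mul, Real.norm_eq_abs]
      refine mul_le_mul_of_nonneg_left ?_ (abs_nonneg _)
      calc _ ≤ ‖-(gG (t - r) (x.1, -x.2)) * u r x‖ + ‖w (t - r) (x.1, -x.2) * gF r x‖ := norm_add_le _ _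
        _ ≤ CLG * CF + CG * CLF := by
            rw [norm_mul, norm_mul, norm_neg]
            exact add_le_add (mul_le_mul (hgGb _ _) (hub _ _) (norm_nonneg _) hCLG0)
              (mul_le_mul (hwb _ _) (hgFb _ _) (norm_nonneg _) hCG0)
    have hbint : Integrable (fun x => |π x * χ x| * (CLG * CF + CG * CLF)) :=
      ((hπc.mul hχc).abs.mul continuous_const).integrable_of_hasCompactSupport (hχs.mul_left.norm.mul_right)
    have hdiff : ∀ᵐ x ∂(volume : Measure (PhaseSpace N)), ∀ r ∈ ball s ε,
        HasDerivAt (fun r => π x * χ x * (w (t - r) (x.1, -x.2) * u r x))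
          (π x * χ x * (-(gG (t - r) (x.1, -x.2)) * u r x + w (t - r) (x.1, -x.2) * gF r x)) r := by
      refine Eventually.of_forall fun x r hr => ?_
      obtain ⟨hr0, hrt⟩ := hball r hr
      have hdu : HasDerivAt (fun r => u r x) (gF r x) r := by
        have h := pinnedChain_hasDerivAt_forecast_dynkin hω hl hβ hγ hN hT hT.le hF hFc hr0 x
        rw [← hgFx] at h
        exact h.congr_of_eventuallyEq (Eventually.of_forall fun r' => hux r' x)
      have hdw : HasDerivAt (fun r => w (t - r) (x.1, -x.2)) (-(gG (t - r) (x.1, -x.2))) r := by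
        have h := pinnedChain_hasDerivAt_forecast_dynkin hω hl hβ hγ hN hT hT.le hGt hGtc (by linarith : 0 < t - r) (x.1, -x.2)
        rw [← hgGx] at h
        have h' : HasDerivAt (fun r' => w r' (x.1, -x.2)) (gG (t - r) (x.1, -x.2)) (t - r) :=
          h.congr_of_eventuallyEq (Eventually.of_forall fun r' => hwx r' (x.1, -x.2))
        have hlin : HasDerivAt (fun r' : ℝ => t - r') (-1) r := (hasDerivAt_id' r).const_sub t
        have hc := h'.comp r hlin
        refine hc.congr_deriv ?_
        ring
      have h := (hdw.mul hdu).const_mul (π x * χ x)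
      refine h.congr_deriv ?_
      ring
    exact (hasDerivAt_integral_of_dominated_loc_of_deriv_le (ball_mem_nhds s hε0)
      (Eventually.of_forall hmeas) hint hmeas' hbound hbint hdiff).2
  rw [hu, hgF, hw, hgG] at hgoal
  exact hgoal


end Duality

end Summit.AtomisticToContinuum.FouriersLaw.Theorems

end
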